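import Summits.RiemannHypothesis.RiemannHypothesis.Theorems.WeilFormatCDataO106FrontDataW
import Summits.RiemannHypothesis.RiemannHypothesis.Theorems.WeilFormatCDataA1RungCB
import Summits.RiemannHypothesis.RiemannHypothesis.Theorems.S2FormatCE0
import Literature.NumberTheory.LFunctions.YoshidaWindowGramTailMSSines
import Literature.NumberTheory.LFunctions.YoshidaWindowGramMiddleJBox
import Literature.NumberTheory.LFunctions.YoshidaWindowGramTailJFactoredScaled
import Literature.NumberTheory.LFunctions.YoshidaWindowGramTailMSFactored
import Literature.NumberTheory.LFunctions.YoshidaWindowGramTailJDiagTight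
import Summits.RiemannHypothesis.RiemannHypothesis.Theorems.FormatCPsdBands
import Summits.RiemannHypothesis.RiemannHypothesis.Theorems.WeilFormatCDiagShift
import Summits.RiemannHypothesis.RiemannHypothesis.Theorems.FormatCPsdSymmBands
import HarnessLib
import Summits.RiemannHypothesis.RiemannHypothesis.Theorems.WeilFormatCDataO106Tables1
import Summits.RiemannHypothesis.RiemannHypothesis.Theorems.WeilFormatCDataO106Tables2
import Summits.RiemannHypothesis.RiemannHypothesis.Theorems.WeilFormatCDataO106Tables3
import Summits.RiemannHypothesis.RiemannHypothesis.Theorems.WeilFormatCDataO106Tables4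
import Summits.RiemannHypothesis.RiemannHypothesis.Theorems.WeilFormatCDataO106Tables5
import Summits.RiemannHypothesis.RiemannHypothesis.Theorems.WeilFormatCDataO106Tables
import Summits.RiemannHypothesis.RiemannHypothesis.Theorems.WeilFormatCDataO106ColTables1
import Summits.RiemannHypothesis.RiemannHypothesis.Theorems.WeilFormatCDataO106ColTables2
import Summits.RiemannHypothesis.RiemannHypothesis.Theorems.WeilFormatCDataO106ColTables3
import Summits.RiemannHypothesis.RiemannHypothesis.Theorems.WeilFormatCDataO106ColTables4
import Summits.RiemannHypothesis.RiemannHypothesis.Theorems.WeilFormatCDataO106ColTables5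
import Summits.RiemannHypothesis.RiemannHypothesis.Theorems.WeilFormatCDataO106ColTables6
import Summits.RiemannHypothesis.RiemannHypothesis.Theorems.WeilFormatCDataO106ColTables7
import Summits.RiemannHypothesis.RiemannHypothesis.Theorems.WeilFormatCDataO106ColTables8
import Summits.RiemannHypothesis.RiemannHypothesis.Theorems.WeilFormatCDataO106ColTables9
import Summits.RiemannHypothesis.RiemannHypothesis.Theorems.WeilFormatCDataO106ColTables10
import Summits.RiemannHypothesis.RiemannHypothesis.Theorems.WeilFormatCDataO106ColTables11
import Summits.RiemannHypothesis.RiemannHypothesis.Theorems.WeilFormatCDataO106ColTables12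
import Summits.RiemannHypothesis.RiemannHypothesis.Theorems.WeilFormatCDataO106ColTables13
import Summits.RiemannHypothesis.RiemannHypothesis.Theorems.WeilFormatCDataO106ColTables14
import Summits.RiemannHypothesis.RiemannHypothesis.Theorems.WeilFormatCDataO106ColTables15
import Summits.RiemannHypothesis.RiemannHypothesis.Theorems.WeilFormatCDataO106ColTables16
import Summits.RiemannHypothesis.RiemannHypothesis.Theorems.WeilFormatCDataO106ColTables17
import Summits.RiemannHypothesis.RiemannHypothesis.Theorems.WeilFormatCDataO106ColTables18
import Summits.RiemannHypothesis.RiemannHypothesis.Theorems.WeilFormatCDataO106ColTables19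
import Summits.RiemannHypothesis.RiemannHypothesis.Theorems.WeilFormatCDataO106ColTables20
import Summits.RiemannHypothesis.RiemannHypothesis.Theorems.WeilFormatCDataO106ColTables21
import Summits.RiemannHypothesis.RiemannHypothesis.Theorems.WeilFormatCDataO106ColTables22
import Summits.RiemannHypothesis.RiemannHypothesis.Theorems.WeilFormatCDataO106ColTables23
import Summits.RiemannHypothesis.RiemannHypothesis.Theorems.WeilFormatCDataO106ColTables24
import Summits.RiemannHypothesis.RiemannHypothesis.Theorems.WeilFormatCDataO106ColTables25
import Summits.RiemannHypothesis.RiemannHypothesis.Theorems.WeilFormatCDataO106ColTables26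
import Summits.RiemannHypothesis.RiemannHypothesis.Theorems.WeilFormatCDataO106ColTables27
import Summits.RiemannHypothesis.RiemannHypothesis.Theorems.WeilFormatCDataO106ColTables28
import Summits.RiemannHypothesis.RiemannHypothesis.Theorems.WeilFormatCDataO106ColTables29
import Summits.RiemannHypothesis.RiemannHypothesis.Theorems.WeilFormatCDataO106ColTables30
import Summits.RiemannHypothesis.RiemannHypothesis.Theorems.WeilFormatCDataO106ColTables31
import Summits.RiemannHypothesis.RiemannHypothesis.Theorems.WeilFormatCDataO106ColTables32
import Summits.RiemannHypothesis.RiemannHypothesis.Theorems.WeilFormatCDataO106ColTables33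
import Summits.RiemannHypothesis.RiemannHypothesis.Theorems.WeilFormatCDataO106ColTables34
import Summits.RiemannHypothesis.RiemannHypothesis.Theorems.WeilFormatCDataO106ColTables35
import Summits.RiemannHypothesis.RiemannHypothesis.Theorems.WeilFormatCDataO106ColTables
import Summits.RiemannHypothesis.RiemannHypothesis.Theorems.WeilFormatCDataO106CBOddXP1
import Summits.RiemannHypothesis.RiemannHypothesis.Theorems.WeilFormatCDataO106CBOddXP2
import Summits.RiemannHypothesis.RiemannHypothesis.Theorems.WeilFormatCDataO106CBOddXP3
import Summits.RiemannHypothesis.RiemannHypothesis.Theorems.WeilFormatCDataO106CBOddXP4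
import Summits.RiemannHypothesis.RiemannHypothesis.Theorems.WeilFormatCDataO106CBOddXP5
import Summits.RiemannHypothesis.RiemannHypothesis.Theorems.WeilFormatCDataO106CBOddXP6
import Summits.RiemannHypothesis.RiemannHypothesis.Theorems.WeilFormatCDataO106CBOddXP7
import Summits.RiemannHypothesis.RiemannHypothesis.Theorems.WeilFormatCDataO106CBOddXP8
import Summits.RiemannHypothesis.RiemannHypothesis.Theorems.WeilFormatCDataO106CBOddXP9
import Summits.RiemannHypothesis.RiemannHypothesis.Theorems.WeilFormatCDataO106CBOddXP10
import Summits.RiemannHypothesis.RiemannHypothesis.Theorems.WeilFormatCDataO106CBOddXP11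
import Summits.RiemannHypothesis.RiemannHypothesis.Theorems.WeilFormatCDataO106CBOddXP12
import Summits.RiemannHypothesis.RiemannHypothesis.Theorems.WeilFormatCDataO106CBOddXP13
import Summits.RiemannHypothesis.RiemannHypothesis.Theorems.WeilFormatCDataO106CBOddXP14
import Summits.RiemannHypothesis.RiemannHypothesis.Theorems.WeilFormatCDataO106CBOddXP15
import Summits.RiemannHypothesis.RiemannHypothesis.Theorems.WeilFormatCDataO106CBOddXP16
import Summits.RiemannHypothesis.RiemannHypothesis.Theorems.WeilFormatCDataO106CBOddXP17
import Summits.RiemannHypothesis.RiemannHypothesis.Theorems.WeilFormatCDataO106CBOddXP18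
import Summits.RiemannHypothesis.RiemannHypothesis.Theorems.WeilFormatCDataO106CBOddXP19
import Summits.RiemannHypothesis.RiemannHypothesis.Theorems.WeilFormatCDataO106CBOddXP20
import Summits.RiemannHypothesis.RiemannHypothesis.Theorems.WeilFormatCDataO106CBOddXP21
import Summits.RiemannHypothesis.RiemannHypothesis.Theorems.WeilFormatCDataO106CBOddXP22
import Summits.RiemannHypothesis.RiemannHypothesis.Theorems.WeilFormatCDataO106CBOddXP23
import Summits.RiemannHypothesis.RiemannHypothesis.Theorems.WeilFormatCDataO106CBOddXP24
import Summits.RiemannHypothesis.RiemannHypothesis.Theorems.WeilFormatCDataO106CBOddXP25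
import Summits.RiemannHypothesis.RiemannHypothesis.Theorems.WeilFormatCDataO106CBOddDSP1
import Summits.RiemannHypothesis.RiemannHypothesis.Theorems.WeilFormatCDataO106CBOddDSP2
import Summits.RiemannHypothesis.RiemannHypothesis.Theorems.WeilFormatCDataO106CBOddDSP3
import Summits.RiemannHypothesis.RiemannHypothesis.Theorems.WeilFormatCDataO106CBOddDSP4
import Summits.RiemannHypothesis.RiemannHypothesis.Theorems.WeilFormatCDataO106CBOddDSP5
import Summits.RiemannHypothesis.RiemannHypothesis.Theorems.WeilFormatCDataO106CBOddDSP6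
import Summits.RiemannHypothesis.RiemannHypothesis.Theorems.WeilFormatCDataO106CBOddDSP7
import Summits.RiemannHypothesis.RiemannHypothesis.Theorems.WeilFormatCDataO106CBOddDSP8
import Summits.RiemannHypothesis.RiemannHypothesis.Theorems.WeilFormatCDataO106CBOddDSP9
import Summits.RiemannHypothesis.RiemannHypothesis.Theorems.WeilFormatCDataO106CBOddDSP10
import Summits.RiemannHypothesis.RiemannHypothesis.Theorems.WeilFormatCDataO106CBOddDSP11
import Summits.RiemannHypothesis.RiemannHypothesis.Theorems.WeilFormatCDataO106CBOddDSP12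
import Summits.RiemannHypothesis.RiemannHypothesis.Theorems.WeilFormatCDataO106CBOddDSP13
import Summits.RiemannHypothesis.RiemannHypothesis.Theorems.WeilFormatCDataO106CBOddDSP14
import Summits.RiemannHypothesis.RiemannHypothesis.Theorems.WeilFormatCDataO106CBOddDSP15
import Summits.RiemannHypothesis.RiemannHypothesis.Theorems.WeilFormatCDataO106CBOddDSP16
import Summits.RiemannHypothesis.RiemannHypothesis.Theorems.WeilFormatCDataO106CBOddDSP17
import Summits.RiemannHypothesis.RiemannHypothesis.Theorems.WeilFormatCDataO106CBOddDSP18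
import Summits.RiemannHypothesis.RiemannHypothesis.Theorems.WeilFormatCDataO106CBOddDSP19
import Summits.RiemannHypothesis.RiemannHypothesis.Theorems.WeilFormatCDataO106CBOddDSP20
import Summits.RiemannHypothesis.RiemannHypothesis.Theorems.WeilFormatCDataO106CBOddDSP21
import Summits.RiemannHypothesis.RiemannHypothesis.Theorems.WeilFormatCDataO106CBOddDSP22
import Summits.RiemannHypothesis.RiemannHypothesis.Theorems.WeilFormatCDataO106CBOddDSP23
import Summits.RiemannHypothesis.RiemannHypothesis.Theorems.WeilFormatCDataO106CBOddDSP24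
import Summits.RiemannHypothesis.RiemannHypothesis.Theorems.WeilFormatCDataO106CBOddDSP25
import Summits.RiemannHypothesis.RiemannHypothesis.Theorems.WeilFormatCDataO106CBOddDSP26
import Summits.RiemannHypothesis.RiemannHypothesis.Theorems.WeilFormatCDataO106CBOddDSP27
import Summits.RiemannHypothesis.RiemannHypothesis.Theorems.WeilFormatCDataO106CBOddDSP28
import Summits.RiemannHypothesis.RiemannHypothesis.Theorems.WeilFormatCDataO106CBOddDSP29
import Summits.RiemannHypothesis.RiemannHypothesis.Theorems.WeilFormatCDataO106CBOddDSP30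
import Summits.RiemannHypothesis.RiemannHypothesis.Theorems.WeilFormatCDataO106CBOddLP1
import Summits.RiemannHypothesis.RiemannHypothesis.Theorems.WeilFormatCDataO106CBOddLP2
import Summits.RiemannHypothesis.RiemannHypothesis.Theorems.WeilFormatCDataO106CBOddLP3
import Summits.RiemannHypothesis.RiemannHypothesis.Theorems.WeilFormatCDataO106CBOddLP4
import Summits.RiemannHypothesis.RiemannHypothesis.Theorems.WeilFormatCDataO106CBOddLP5
import Summits.RiemannHypothesis.RiemannHypothesis.Theorems.WeilFormatCDataO106CBOddLP6
import Summits.RiemannHypothesis.RiemannHypothesis.Theorems.WeilFormatCDataO106CBOddLP7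
import Summits.RiemannHypothesis.RiemannHypothesis.Theorems.WeilFormatCDataO106CBOddLP8
import Summits.RiemannHypothesis.RiemannHypothesis.Theorems.WeilFormatCDataO106CBOddLP9
import Summits.RiemannHypothesis.RiemannHypothesis.Theorems.WeilFormatCDataO106CBOddLP10
import Summits.RiemannHypothesis.RiemannHypothesis.Theorems.WeilFormatCDataO106CBOddLP11
import Summits.RiemannHypothesis.RiemannHypothesis.Theorems.WeilFormatCDataO106CBOddLP12
import Summits.RiemannHypothesis.RiemannHypothesis.Theorems.WeilFormatCDataO106CBOddPhiP1
import Summits.RiemannHypothesis.RiemannHypothesis.Theorems.WeilFormatCDataO106CBOddPsiP1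
import Summits.RiemannHypothesis.RiemannHypothesis.Theorems.WeilFormatCDataO106CBOddRD
import Summits.RiemannHypothesis.RiemannHypothesis.Theorems.WeilFormatCDataO106FrontData
import Summits.RiemannHypothesis.RiemannHypothesis.Theorems.WeilFormatCDataO106TabValid11A
import Summits.RiemannHypothesis.RiemannHypothesis.Theorems.WeilFormatCDataO106TabValid11B
import Summits.RiemannHypothesis.RiemannHypothesis.Theorems.WeilFormatCDataO106TabValid
import Summits.RiemannHypothesis.RiemannHypothesis.Theorems.WeilFormatCDataO106OddAsmA
import Summits.RiemannHypothesis.RiemannHypothesis.Theorems.WeilFormatCDataO106OddAsmE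

/-!
# Format C kernel rung `O106` (a = 53/50, column-band layout): ASSEMBLY of the flat layout, part F of 26 (ladders of TabValid11, TabValid; split of the 4013-line assembly at block boundaries by prover B g19 for the 400-line cap; blocks byte-identical): every propositional ladder of the kernel files (table/column validity, front door, sines, middle moments, column data, tail factors, Schur rows, (P) + diagonal shift), byte-identical statements and proofs, original order (A g22 restage_flat.py; weil-2 KERNEL-CHAIN-RULES #1)

Window `a = 53/50`; prime powers in the window: 2, 3, 2^2, 5, 7, 2^3; prime constant A = 2358/1000 (`WeilFormatC.primeCoeff_form_ge_cells_1098`); evaluator parameters S = 2^320, Kpi 160, Kser 190, kred 8, Kexp 55, J 150; full table modes < 321; light column table modes < 2051; units 2^-310 (Schur entries), 2^-154 (column digits, width 157), 2^-148 (tail-factor digits, width 151), 2^-64 (reciprocal weights), 2^-40 (tail base); order-J tail J = 4, θ = 1/2048, η = 1/10 | 4/1.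
Design row: sr-gb-rung-b B g21 hp odd λ-run (parity CELL 15 L-side, the first window PAST the (log 8)/2 resonance): a = 53/50, SIX prime powers 2,3,4,5,7,8 (kmax 8), A = 2358/1000 (WeilFormatC.primeCoeff_form_ge_cells_1098), μ = 2^-103, odd 320/640/2048, kit precision S 2^320 / c 310 / Kpi 160 / Kser 190 / Kexp 55 / J 150; pairs with A g24 trialUpper1035sharp = 21e-33; see HOME(B)/CELL14-LSIDE-B-g21.md §4. Generated by sr-gb-rung-a prover A g22 with rh-explicit-weil-2 gen7's generator extended for the odd λ-run (--sector odd --mu-log2; HOME(A)/code-g22/gen7/gramgen7.py sha16 b21c15hp1060001) from `#eval` of the tree's `Encl` functions; every datum is re-verified by the kernel in the theorem files (`decide +kernel`). Helper data of the rh-explicit Weil-positivity programme (format C, K-CELL-2), RH-free. [cite: Yoshida1992HermitianForms, §5 (5.15)-(5.16) p. 301; §7 pp. 305–312]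
-/

set_option linter.dupNamespace false
set_option exponentiation.threshold 1024
set_option maxRecDepth 200000

-- ===== from WeilFormatCDataO106TabValid11A / WeilFormatCDataO106TabValid11B =====
namespace Summit.RiemannHypothesis.RiemannHypothesis.Theorems.WeilFormatCData.O106
open Literature.NumberTheory.LFunctions Literature.NumberTheory.LFunctions.Yoshida1992 Encl Literature.Analysis.ValidatedNumerics.NumericsMP

/-- the special-value table is valid below `320` (partial). -/
theorem tabv320 : TabValid (2 ^ 320) O106.a O106.ks 320 O106.tab := by
  have h290 : TabValid (2 ^ 320) a ks 290 tab := tabv290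
  have h291 : TabValid (2 ^ 320) a ks (290 + 1) tab :=
    h290.extend fun n hn hnk ↦ idxValid_of_checkTable (prm := prm) (by norm_num [prm]) a_pos consts_valid tT290 hn hnk
  have h292 : TabValid (2 ^ 320) a ks (291 + 1) tab :=
    h291.extend fun n hn hnk ↦ idxValid_of_checkTable (prm := prm) (by norm_num [prm]) a_pos consts_valid tT291 hn hnk
  have h293 : TabValid (2 ^ 320) a ks (292 + 1) tab :=
    h292.extend fun n hn hnk ↦ idxValid_of_checkTable (prm := prm) (by norm_num [prm]) a_pos consts_valid tT292 hn hnk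
  have h294 : TabValid (2 ^ 320) a ks (293 + 1) tab :=
    h293.extend fun n hn hnk ↦ idxValid_of_checkTable (prm := prm) (by norm_num [prm]) a_pos consts_valid tT293 hn hnk
  have h295 : TabValid (2 ^ 320) a ks (294 + 1) tab :=
    h294.extend fun n hn hnk ↦ idxValid_of_checkTable (prm := prm) (by norm_num [prm]) a_pos consts_valid tT294 hn hnk
  have h296 : TabValid (2 ^ 320) a ks (295 + 1) tab :=
    h295.extend fun n hn hnk ↦ idxValid_of_checkTable (prm := prm) (by norm_num [prm]) a_pos consts_valid tT295 hn hnk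
  have h297 : TabValid (2 ^ 320) a ks (296 + 1) tab :=
    h296.extend fun n hn hnk ↦ idxValid_of_checkTable (prm := prm) (by norm_num [prm]) a_pos consts_valid tT296 hn hnk
  have h298 : TabValid (2 ^ 320) a ks (297 + 1) tab :=
    h297.extend fun n hn hnk ↦ idxValid_of_checkTable (prm := prm) (by norm_num [prm]) a_pos consts_valid tT297 hn hnk
  have h299 : TabValid (2 ^ 320) a ks (298 + 1) tab :=
    h298.extend fun n hn hnk ↦ idxValid_of_checkTable (prm := prm) (by norm_num [prm]) a_pos consts_valid tT298 hn hnk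
  have h300 : TabValid (2 ^ 320) a ks (299 + 1) tab :=
    h299.extend fun n hn hnk ↦ idxValid_of_checkTable (prm := prm) (by norm_num [prm]) a_pos consts_valid tT299 hn hnk
  have h301 : TabValid (2 ^ 320) a ks (300 + 1) tab :=
    h300.extend fun n hn hnk ↦ idxValid_of_checkTable (prm := prm) (by norm_num [prm]) a_pos consts_valid tT300 hn hnk
  have h302 : TabValid (2 ^ 320) a ks (301 + 1) tab :=
    h301.extend fun n hn hnk ↦ idxValid_of_checkTable (prm := prm) (by norm_num [prm]) a_pos consts_valid tT301 hn hnk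
  have h303 : TabValid (2 ^ 320) a ks (302 + 1) tab :=
    h302.extend fun n hn hnk ↦ idxValid_of_checkTable (prm := prm) (by norm_num [prm]) a_pos consts_valid tT302 hn hnk
  have h304 : TabValid (2 ^ 320) a ks (303 + 1) tab :=
    h303.extend fun n hn hnk ↦ idxValid_of_checkTable (prm := prm) (by norm_num [prm]) a_pos consts_valid tT303 hn hnk
  have h305 : TabValid (2 ^ 320) a ks (304 + 1) tab :=
    h304.extend fun n hn hnk ↦ idxValid_of_checkTable (prm := prm) (by norm_num [prm]) a_pos consts_valid tT304 hn hnk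
  have h306 : TabValid (2 ^ 320) a ks (305 + 1) tab :=
    h305.extend fun n hn hnk ↦ idxValid_of_checkTable (prm := prm) (by norm_num [prm]) a_pos consts_valid tT305 hn hnk
  have h307 : TabValid (2 ^ 320) a ks (306 + 1) tab :=
    h306.extend fun n hn hnk ↦ idxValid_of_checkTable (prm := prm) (by norm_num [prm]) a_pos consts_valid tT306 hn hnk
  have h308 : TabValid (2 ^ 320) a ks (307 + 1) tab :=
    h307.extend fun n hn hnk ↦ idxValid_of_checkTable (prm := prm) (by norm_num [prm]) a_pos consts_valid tT307 hn hnk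
  have h309 : TabValid (2 ^ 320) a ks (308 + 1) tab :=
    h308.extend fun n hn hnk ↦ idxValid_of_checkTable (prm := prm) (by norm_num [prm]) a_pos consts_valid tT308 hn hnk
  have h310 : TabValid (2 ^ 320) a ks (309 + 1) tab :=
    h309.extend fun n hn hnk ↦ idxValid_of_checkTable (prm := prm) (by norm_num [prm]) a_pos consts_valid tT309 hn hnk
  have h311 : TabValid (2 ^ 320) a ks (310 + 1) tab :=
    h310.extend fun n hn hnk ↦ idxValid_of_checkTable (prm := prm) (by norm_num [prm]) a_pos consts_valid tT310 hn hnk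
  have h312 : TabValid (2 ^ 320) a ks (311 + 1) tab :=
    h311.extend fun n hn hnk ↦ idxValid_of_checkTable (prm := prm) (by norm_num [prm]) a_pos consts_valid tT311 hn hnk
  have h313 : TabValid (2 ^ 320) a ks (312 + 1) tab :=
    h312.extend fun n hn hnk ↦ idxValid_of_checkTable (prm := prm) (by norm_num [prm]) a_pos consts_valid tT312 hn hnk
  have h314 : TabValid (2 ^ 320) a ks (313 + 1) tab :=
    h313.extend fun n hn hnk ↦ idxValid_of_checkTable (prm := prm) (by norm_num [prm]) a_pos consts_valid tT313 hn hnk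
  have h315 : TabValid (2 ^ 320) a ks (314 + 1) tab :=
    h314.extend fun n hn hnk ↦ idxValid_of_checkTable (prm := prm) (by norm_num [prm]) a_pos consts_valid tT314 hn hnk
  have h316 : TabValid (2 ^ 320) a ks (315 + 1) tab :=
    h315.extend fun n hn hnk ↦ idxValid_of_checkTable (prm := prm) (by norm_num [prm]) a_pos consts_valid tT315 hn hnk
  have h317 : TabValid (2 ^ 320) a ks (316 + 1) tab :=
    h316.extend fun n hn hnk ↦ idxValid_of_checkTable (prm := prm) (by norm_num [prm]) a_pos consts_valid tT316 hn hnk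
  have h318 : TabValid (2 ^ 320) a ks (317 + 1) tab :=
    h317.extend fun n hn hnk ↦ idxValid_of_checkTable (prm := prm) (by norm_num [prm]) a_pos consts_valid tT317 hn hnk
  have h319 : TabValid (2 ^ 320) a ks (318 + 1) tab :=
    h318.extend fun n hn hnk ↦ idxValid_of_checkTable (prm := prm) (by norm_num [prm]) a_pos consts_valid tT318 hn hnk
  have h320 : TabValid (2 ^ 320) a ks (319 + 1) tab :=
    h319.extend fun n hn hnk ↦ idxValid_of_checkTable (prm := prm) (by norm_num [prm]) a_pos consts_valid tT319 hn hnk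
  exact h320

end Summit.RiemannHypothesis.RiemannHypothesis.Theorems.WeilFormatCData.O106

-- ===== from WeilFormatCDataO106TabValid =====
namespace Summit.RiemannHypothesis.RiemannHypothesis.Theorems.WeilFormatCData.O106
open Literature.NumberTheory.LFunctions Literature.NumberTheory.LFunctions.Yoshida1992 Encl Literature.Analysis.ValidatedNumerics.NumericsMP

/-- the special-value table is valid below `321`. -/
theorem tab_valid : TabValid (2 ^ 320) O106.a O106.ks 321 O106.tab := by
  have h320 : TabValid (2 ^ 320) a ks 320 tab := tabv320
  have h321 : TabValid (2 ^ 320) a ks (320 + 1) tab :=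
    h320.extend fun n hn hnk ↦ idxValid_of_checkTable (prm := prm) (by norm_num [prm]) a_pos consts_valid tT320 hn hnk
  exact h321

/-- full table for the odd rows. -/
theorem tab_valid_odd : TabValid (2 ^ 320) O106.a O106.ks (320 + 1) O106.tab := fun n hn ↦ tab_valid n (by omega)

end Summit.RiemannHypothesis.RiemannHypothesis.Theorems.WeilFormatCData.O106
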